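import Summits.Ventures.PercRepro.ThetaSigmaStar

/-!
# (Σ): the star — on ≥ 4 points, credit-free co-pair points everywhere force `∅ ∈ X`

Dossier proofs/MINE1-theoremS.md, Addendum 78 (mine-1, gen 40). With the two-point star lemma
of `ThetaSigmaStar.lean` (two points carrying co-pairs with trivial credits share a co-pair member
avoiding both), the co-pairs of any three such points `p, q, r` either share ONE member or form a
triangle `{m_pq, m_pr}, {m_pq, m_qr}, {m_pr, m_qr}` whose three unions are `U ∖ p`, `U ∖ q`,
`U ∖ r`; a fourth point of `U` would then lie in exactly one member of each of the three pairs —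
impossible by parity. Hence (`empty_mem_of_forall_copair_creditTrivial`): **on a ground set of at
least four points, if every point carries a co-pair with trivial credit, one member avoids every
point, i.e. `∅ ∈ X`**; and (`exists_not_copair_or_not_creditTrivial`) a family without `∅` always
has a point carrying no co-pair or a non-trivial credit — with the classification of Addendum 76
(the Credit Lemma fails only at credit-trivial co-pair points), this is the Credit Lemma.
-/

namespace PercRepro.MSTight

open Finset

variable {α : Type*} [DecidableEq α]

section Star

variable {U : Finset α} {X : Finset (Finset α)}

/-- Two distinct members of a co-pair form that co-pair (in some order). -/
theorem isCopairAt_of_mem_of_ne {p : α} {x y a b : Finset α} (hc : IsCopairAt U p X x y)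
    (ha : a = x ∨ a = y) (hb : b = x ∨ b = y) (hab : a ≠ b) : IsCopairAt U p X a b := by
  rcases ha with rfl | rfl <;> rcases hb with rfl | rfl
  · exact absurd rfl hab
  · exact hc
  · exact hc.symm
  · exact absurd rfl hab

/-- A point `s ∈ U ∖ p` lies in exactly one member of a co-pair at `p`. -/
theorem IsCopairAt.xor_of_mem {p : α} {x y : Finset α} (hc : IsCopairAt U p X x y) {s : α}
    (hs : s ∈ U) (hsp : s ≠ p) : (s ∈ x ∧ s ∉ y) ∨ (s ∉ x ∧ s ∈ y) := by
  have h := hc.mem_iff s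
  rcases (h.1).1 ⟨hsp, hs⟩ with hx | hy
  · exact Or.inl ⟨hx, fun hy => h.2 ⟨hx, hy⟩⟩
  · exact Or.inr ⟨fun hx => h.2 ⟨hx, hy⟩, hy⟩

/-- Two co-pairs at distinct points are distinct as pairs: their unions differ. -/
theorem ne_of_isCopairAt {p q : α} {x y : Finset α} (hq : q ∈ U) (hpq : p ≠ q)
    (hcp : IsCopairAt U p X x y) (hcq : IsCopairAt U q X x y) : False := by
  have h : U.erase p = U.erase q := hcp.2.2.2.symm.trans hcq.2.2.2
  have : q ∈ U.erase p := mem_erase.2 ⟨Ne.symm hpq, hq⟩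
  rw [h] at this
  exact (mem_erase.1 this).1 rfl

/-- **The star**: on a ground set of at least four points, if every point carries a co-pair with
trivial credit, then the shared members of all pairs of points coincide and avoid every point —
`∅` is a member. -/
theorem empty_mem_of_forall_copair_creditTrivial (hU4 : 4 ≤ U.card) (hX : ∀ x ∈ X, x ⊆ U)
    (h : ∀ p ∈ U, (∃ x y, IsCopairAt U p X x y) ∧ CreditTrivialAt U p X) : (∅ : Finset α) ∈ X := by
  choose! x y hxy using fun p hp => (h p hp).1
  have ht : ∀ p ∈ U, CreditTrivialAt U p X := fun p hp => (h p hp).2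
  have hshare : ∀ p ∈ U, ∀ q ∈ U, p ≠ q →
      ∃ m ∈ X, p ∉ m ∧ q ∉ m ∧ (m = x p ∨ m = y p) ∧ (m = x q ∨ m = y q) :=
    fun p hp q hq hpq => copair_inter_of_creditTrivial hp hq hpq (hxy p hp) (hxy q hq) (ht p hp)
      (ht q hq)
  choose! m hm using hshare
  -- the shared members of a triple coincide
  have key : ∀ p ∈ U, ∀ q ∈ U, ∀ r ∈ U, p ≠ q → p ≠ r → q ≠ r → m p q = m p r := by
    intro p hp q hq r hr hpq hpr hqr
    by_contra hne
    obtain ⟨-, -, -, hpq1, hpq2⟩ := hm p hp q hq hpq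
    obtain ⟨-, -, -, hpr1, hpr2⟩ := hm p hp r hr hpr
    obtain ⟨-, -, -, hqr1, hqr2⟩ := hm q hq r hr hqr
    -- the co-pair at `p` is `{m p q, m p r}`
    have cP : IsCopairAt U p X (m p q) (m p r) := isCopairAt_of_mem_of_ne (hxy p hp) hpq1 hpr1 hne
    -- `m q r ≠ m p q`: otherwise the co-pair at `r` would be the co-pair at `p`
    have hne2 : m q r ≠ m p q := by
      intro heq
      have cR : IsCopairAt U r X (m p q) (m p r) :=
        isCopairAt_of_mem_of_ne (hxy r hr) (heq ▸ hqr2) hpr2 hne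
      exact ne_of_isCopairAt hr hpr cP cR
    have hne3 : m q r ≠ m p r := by
      intro heq
      have cQ : IsCopairAt U q X (m p q) (m p r) :=
        isCopairAt_of_mem_of_ne (hxy q hq) hpq2 (heq ▸ hqr1) hne
      exact ne_of_isCopairAt hq hpq cP cQ
    have cQ : IsCopairAt U q X (m p q) (m q r) :=
      isCopairAt_of_mem_of_ne (hxy q hq) hpq2 hqr1 (Ne.symm hne2)
    have cR : IsCopairAt U r X (m p r) (m q r) :=
      isCopairAt_of_mem_of_ne (hxy r hr) hpr2 hqr2 (Ne.symm hne3)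
    -- a fourth point sees the triangle
    have hlt : ({p, q, r} : Finset α).card < U.card := by
      have := card_le_three (a := p) (b := q) (c := r)
      omega
    obtain ⟨s, hsU, hs⟩ := exists_mem_notMem_of_card_lt_card hlt
    simp only [mem_insert, mem_singleton, not_or] at hs
    have e1 := cP.xor_of_mem hsU hs.1
    have e2 := cQ.xor_of_mem hsU hs.2.1
    have e3 := cR.xor_of_mem hsU hs.2.2
    rcases e1 with ⟨h1, h2⟩ | ⟨h1, h2⟩ <;> rcases e2 with ⟨h3, h4⟩ | ⟨h3, h4⟩ <;>
      rcases e3 with ⟨h5, h6⟩ | ⟨h5, h6⟩ <;>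
      first
      | exact absurd h1 h3
      | exact absurd h3 h1
      | exact absurd h2 h5
      | exact absurd h5 h2
      | exact absurd h4 h6
      | exact absurd h6 h4
  -- two points exist
  have h2 : ({ } : Finset α).card < U.card := by
    rw [card_empty]; omega
  obtain ⟨p, hp, -⟩ := exists_mem_notMem_of_card_lt_card h2
  have h2' : ({p} : Finset α).card < U.card := by
    rw [card_singleton]; omega
  obtain ⟨q, hq, hqp⟩ := exists_mem_notMem_of_card_lt_card h2'
  rw [mem_singleton] at hqp
  have hpq : p ≠ q := Ne.symm hqp
  obtain ⟨hmX, hpm, hqm, -, -⟩ := hm p hp q hq hpq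
  -- the shared member avoids every point of `U`
  have havoid : ∀ t ∈ U, t ∉ m p q := by
    intro t htU htm
    by_cases htp : t = p
    · exact hpm (htp ▸ htm)
    by_cases htq : t = q
    · exact hqm (htq ▸ htm)
    have := key p hp q hq t htU hpq (Ne.symm htp) (Ne.symm htq)
    rw [this] at htm
    exact (hm p hp t htU (Ne.symm htp)).2.2.1 htm
  have hempty : m p q = ∅ := by
    rw [eq_empty_iff_forall_notMem]
    intro t htm
    exact havoid t (hX _ hmX htm) htm
  rw [← hempty]
  exact hmX

/-- **Some point is not a credit-free co-pair point**: a family without `∅` on at least four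
points has a point carrying no co-pair or a non-trivial credit. -/
theorem exists_not_copair_or_not_creditTrivial (hU4 : 4 ≤ U.card) (hX : ∀ x ∈ X, x ⊆ U)
    (h0 : (∅ : Finset α) ∉ X) :
    ∃ p ∈ U, (∀ x y, ¬ IsCopairAt U p X x y) ∨ ¬ CreditTrivialAt U p X := by
  by_contra hcon
  apply h0
  apply empty_mem_of_forall_copair_creditTrivial hU4 hX
  intro p hp
  by_contra hnot
  apply hcon
  refine ⟨p, hp, ?_⟩
  by_cases hc : ∃ x y, IsCopairAt U p X x y
  · right
    intro ht
    exact hnot ⟨hc, ht⟩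
  · left
    intro x y hxy
    exact hc ⟨x, y, hxy⟩

end Star

end PercRepro.MSTight
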